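import Mathlib
import Literature.AlgebraicGeometry.Resolution.PointBlowupFlagInvariant
import Summits.ResolutionOfSingularities.ResolutionOfSingularities.Theorems.WeightedInvariantLocalWeightedDropWildPurePowerFlagDefs
import Summits.ResolutionOfSingularities.ResolutionOfSingularities.Theorems.WeightedInvariantLocalWeightedDropWildMonicShift
import Summits.ResolutionOfSingularities.ResolutionOfSingularities.Theorems.WeightedInvariantLocalWeightedDropWildMonicFlagDefs
import Summits.ResolutionOfSingularities.ResolutionOfSingularities.Theorems.WeightedInvariantLocalWeightedDropWildMonicFlagNnDefs

/-!
# `WeightedInvariant.LocalWeightedDrop`, line `hasse-ridge-face-selection`, S3ρ sub-stub S3ρD `stub_wildMonicSurfaceDescent`: item D-0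
# «maximising flag» — the FLAG FAMILY of a monic tuple and its FLAG TRIPLE `(d_𝓕, n_𝓕, s_𝓕)` (D-0a definitions)

Crux item stmt-ResolutionOfSingularities-8899 `LocalWeightedDrop` (route `ResolutionOfSingularities/WeightedInvariant`), engine of the door
`HypersurfaceCentreConstruction` stmt-ResolutionOfSingularities-19897.  [OURS · L1 W4.3, chain w43, res-L1-w43-stub-3 (gen 3) on roadmap item
D-0 of `L/res-L1-w43-stub-7/S3RHOD-ROADMAP.md` §3 (C5), under the S3ρ owners res-type-083 / stub-7 (plan-1 RULINGS gen 8 #1 (iv); 083's ACK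
+ (C9) decisions 07:15:48Z: Triple/embed of the tree, swap-equivariance by construction, NO Exit/measure here — (C9)'s `measureΦ` /
`AttainShape Φ` / `DropShape Φ` are generic in the predicate `Φ := WildMonic.IsFlagTriple`).  Spec: `L/res-L1-w43-stub-3/D0-SPEC.md` §1–§2.
MODEL: S. Perlega, thesis Wien 2017 / arXiv:2011.14443 §7.2 (flags `𝓕 = (𝓕₂ ⊃ 𝓕₁)`, invariants `m_𝓕, d_𝓕, n_𝓕, s_𝓕`; §7.2.3 «valid» =
`m`-maximal among comparable flags; «maximizing» = lex-greatest `(d, n, s)` among valid flags) = Hauser–Perlega, Publ. RIMS 60 (2024) §8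
for general multiplicity; OUR objects, read on the coefficient tuple of the game's monic form in the flag's own subordinate parameters.]

THE FAMILY.  A flag of the position `A = (A_j)_{j<d}` (`y^d + Σ A_j y^j`) with boundary letters `E ⊆ {0, 1}` is a triple
`(o, g, h)`: an ORIENTATION `o : Bool` (which plane letter carries the curve; read on stub-1's letter swap `PurePowerFlag.swap/orient`),
a HYPERSURFACE RE-CENTRING `g ∈ k⟦x₀,x₁⟧`, `g(0) = 0` (`𝓕₂ = V(y + g)`; res-type-083's `WildMonic.shift`), and a PLANE SHEAR `h ∈ k⟦x⟧`,
`h(0) = 0` (`𝓕₁ = V(y + g, x₁ + h(x₀))`; stub-1's `PurePowerFlag.shift h`).  `flagTuple d A g h` is the tuple in the flag's subordinate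
parameters — exactly the data `(θ, φ) = (PurePowerFlag.shift h, g)` the descent datum plays as its free moves in S3ρD₃'s step.
THE NUMBERS, on `N = newtonSet (flagTuple …)` (stub-7's `d!`-scaled Newton set, p500044): case `n = 0` (stub-1's `IsN0 E h`): `m = r₀ + r₁`
(`r = WildMonic.excExp E N`, Per17 «`m_𝓕 = ord M₂`»), `d = dRes E N` («`ord I₂`»), `s = sValue d! E N` («`ord J₁`», three-way split); case
`n ≥ 1` (stub-1's `IsTangent E h`, `n = ord h`): `m = mFlagN d! n N`, `d = dFlagN d! n N` (stub-5, p506745), `s = 0`.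
VALIDITY is `m`-maximality over the hypersurfaces `g′` WITH THE SAME PLANE FLAG (`IsMMax`; Per17 Lemma 7.4.2: within a class `m` depends on
`𝓕₂` only) — needed because an invalid `g` can carry a larger `d` (D0-SPEC §1).  `IsFlagTriple d A E v`: `v ∈ Triple = ℕ ×ₗ ℕ ×ₗ ℕ∞` is the
triple of a VALID admissible flag of either orientation — swap-equivariant by construction (`isFlagTriple_swapT`).
-/

set_option linter.dupNamespace false -- mandated namespace of this single-conjunct summit

noncomputable section

namespace Summit.ResolutionOfSingularities.ResolutionOfSingularities.Theorems

namespace WildMonic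

open MvPowerSeries
open Literature.AlgebraicGeometry.Resolution
open Literature.AlgebraicGeometry.Resolution.HauserPerlega2024 (Triple)
open PurePowerFlag (swap swapE orient orientE IsN0 IsTangent)

variable {k : Type} [Field k] {d : ℕ}

/-! ## The letter swap and orientation of a tuple -/

/-- The letter swap `x₀ ↔ x₁` of a tuple, slot by slot (stub-1's `PurePowerFlag.swap`). -/
def swapT (A : Fin d → MvPowerSeries (Fin 2) k) : Fin d → MvPowerSeries (Fin 2) k := fun j => swap (A j)

/-- Orientation selector on tuples: `orientT false A = A`, `orientT true A = swapT A`. -/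
def orientT (o : Bool) (A : Fin d → MvPowerSeries (Fin 2) k) : Fin d → MvPowerSeries (Fin 2) k := if o then swapT A else A

/-! ## The tuple in the flag's subordinate parameters -/

/-- `flagTuple d A g h`: the coefficient tuple of `y^d + Σ A_j y^j` in the parameters `(y + g, x₀, x₁ + h(x₀))` subordinate to the flag
`𝓕₂ = V(y + g) ⊃ 𝓕₁ = V(y + g, x₁ + h(x₀))` of the first orientation: shear the plane by `h`, then re-centre by `g`. -/
def flagTuple (d : ℕ) (A : Fin d → MvPowerSeries (Fin 2) k) (g : MvPowerSeries (Fin 2) k) (h : PowerSeries k) :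
    Fin d → MvPowerSeries (Fin 2) k :=
  WildMonic.shift d (fun j => subst (PurePowerFlag.shift h) (A j)) g

/-! ## The flag numbers (first orientation) -/

/-- `m_𝓕` on the `d!`-scale (Per17 §7.2: `ord M₂` for `n_𝓕 = 0`, `mFlagN` for `n_𝓕 ≥ 1`). -/
def mOf (d : ℕ) (A : Fin d → MvPowerSeries (Fin 2) k) (E : Finset (Fin 2)) (g : MvPowerSeries (Fin 2) k) (h : PowerSeries k) : ℕ := by
  classical
  exact if IsN0 E h then
      excExp E (newtonSet (flagTuple d A g h)) 0 + excExp E (newtonSet (flagTuple d A g h)) 1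
    else mFlagN d.factorial (PurePowerFlag.tangency h) (newtonSet (flagTuple d A g h))

/-- The FLAG TRIPLE `(d_𝓕, n_𝓕, s_𝓕)` (first orientation): `(dRes, 0, sValue d!)` for `n = 0`, `(dFlagN d! n, n, 0)` with `n = ord h`
for tangent flags (Per17 §7.2 (a)/(b); Hauser–Perlega's `0` where Perlega prints `−1`). -/
def flagTriple (d : ℕ) (A : Fin d → MvPowerSeries (Fin 2) k) (E : Finset (Fin 2)) (g : MvPowerSeries (Fin 2) k) (h : PowerSeries k) :
    Triple := by
  classical
  exact if IsN0 E h then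
      toLex (dRes E (newtonSet (flagTuple d A g h)), toLex (0, sValue d.factorial E (newtonSet (flagTuple d A g h))))
    else toLex (dFlagN d.factorial (PurePowerFlag.tangency h) (newtonSet (flagTuple d A g h)),
      toLex (PurePowerFlag.tangency h, (0 : ℕ∞)))

/-- VALIDITY (Per17 §7.2.3 «`m_𝓖 ≤ m_𝓕` for all comparable `𝓖`», read within the plane flag): the hypersurface `g` maximises `m` among all
hypersurface re-centrings with the same orientation, plane shear and boundary. -/
def IsMMax (d : ℕ) (A : Fin d → MvPowerSeries (Fin 2) k) (E : Finset (Fin 2)) (g : MvPowerSeries (Fin 2) k) (h : PowerSeries k) : Prop :=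
  ∀ g' : MvPowerSeries (Fin 2) k, constantCoeff g' = 0 → mOf d A E g' h ≤ mOf d A E g h

/-- `v` IS THE TRIPLE OF A VALID ADMISSIBLE FLAG of the position `(A, E)`, of either orientation (`o = true`: a flag whose curve letter is
`x₀`, read as a first-orientation flag of the letter swap). The predicate `Φ` of (C9)'s `measureΦ` / `AttainShape` / `DropShape`.
[cite: Perlega2020, §7.2.3 (valid and maximizing flags), arXiv:2011.14443 chunk p0088 L154–L165] -/
def IsFlagTriple (d : ℕ) (A : Fin d → MvPowerSeries (Fin 2) k) (E : Finset (Fin 2)) (v : Triple) : Prop :=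
  ∃ (o : Bool) (g : MvPowerSeries (Fin 2) k) (h : PowerSeries k), constantCoeff g = 0 ∧ PowerSeries.constantCoeff h = 0 ∧
    (IsN0 (orientE o E) h ∨ IsTangent (orientE o E) h) ∧ IsMMax d (orientT o A) (orientE o E) g h ∧
    v = flagTriple d (orientT o A) (orientE o E) g h

/-! ## Unfoldings -/

/-- Components of the tuple swap. -/
theorem swapT_apply (A : Fin d → MvPowerSeries (Fin 2) k) (j : Fin d) : swapT A j = swap (A j) := rfl

/-- The letter swap of tuples is an involution. -/
theorem swapT_swapT (A : Fin d → MvPowerSeries (Fin 2) k) : swapT (swapT A) = A := by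
  funext j
  rw [swapT_apply, swapT_apply, PurePowerFlag.swap_swap]

/-- First orientation: the tuple itself. -/
theorem orientT_false (A : Fin d → MvPowerSeries (Fin 2) k) : orientT false A = A := rfl

/-- Second orientation: the swapped tuple. -/
theorem orientT_true (A : Fin d → MvPowerSeries (Fin 2) k) : orientT true A = swapT A := rfl

/-- Orientations compose with the swap: `orientT o (swapT A) = orientT (!o) A`. -/
theorem orientT_swapT (o : Bool) (A : Fin d → MvPowerSeries (Fin 2) k) : orientT o (swapT A) = orientT (!o) A := by
  cases o
  · rfl
  · show swapT (swapT A) = A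
    exact swapT_swapT A

/-- Unfolding `flagTuple`. -/
theorem flagTuple_def (d : ℕ) (A : Fin d → MvPowerSeries (Fin 2) k) (g : MvPowerSeries (Fin 2) k) (h : PowerSeries k) :
    flagTuple d A g h = WildMonic.shift d (fun j => subst (PurePowerFlag.shift h) (A j)) g := rfl

/-- `m` of an `n = 0` flag: the degree `r₀ + r₁` of the exceptional monomial. -/
theorem mOf_of_isN0 {A : Fin d → MvPowerSeries (Fin 2) k} {E : Finset (Fin 2)} {g : MvPowerSeries (Fin 2) k} {h : PowerSeries k}
    (hn : IsN0 E h) :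
    mOf d A E g h = excExp E (newtonSet (flagTuple d A g h)) 0 + excExp E (newtonSet (flagTuple d A g h)) 1 := by
  classical
  unfold mOf
  rw [if_pos hn]

/-- `m` of a tangent flag: `mFlagN d! (ord h)`. -/
theorem mOf_of_not_isN0 {A : Fin d → MvPowerSeries (Fin 2) k} {E : Finset (Fin 2)} {g : MvPowerSeries (Fin 2) k} {h : PowerSeries k}
    (hn : ¬ IsN0 E h) : mOf d A E g h = mFlagN d.factorial (PurePowerFlag.tangency h) (newtonSet (flagTuple d A g h)) := by
  classical
  unfold mOf
  rw [if_neg hn]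

/-- The triple of an `n = 0` flag: `(dRes, 0, sValue d!)`. -/
theorem flagTriple_of_isN0 {A : Fin d → MvPowerSeries (Fin 2) k} {E : Finset (Fin 2)} {g : MvPowerSeries (Fin 2) k} {h : PowerSeries k}
    (hn : IsN0 E h) : flagTriple d A E g h =
      toLex (dRes E (newtonSet (flagTuple d A g h)), toLex (0, sValue d.factorial E (newtonSet (flagTuple d A g h)))) := by
  classical
  unfold flagTriple
  rw [if_pos hn]

/-- The triple of a tangent flag: `(dFlagN d! n, n, 0)`, `n = ord h`. -/
theorem flagTriple_of_not_isN0 {A : Fin d → MvPowerSeries (Fin 2) k} {E : Finset (Fin 2)} {g : MvPowerSeries (Fin 2) k}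
    {h : PowerSeries k} (hn : ¬ IsN0 E h) : flagTriple d A E g h =
      toLex (dFlagN d.factorial (PurePowerFlag.tangency h) (newtonSet (flagTuple d A g h)), toLex (PurePowerFlag.tangency h, (0 : ℕ∞))) := by
  classical
  unfold flagTriple
  rw [if_neg hn]

open Classical in
/-- The `n`-component of a flag triple: `0` for `n = 0` flags, `ord h` for tangent flags. -/
theorem flagTriple_snd_fst (A : Fin d → MvPowerSeries (Fin 2) k) (E : Finset (Fin 2)) (g : MvPowerSeries (Fin 2) k) (h : PowerSeries k) :
    (ofLex (ofLex (flagTriple d A E g h)).2).1 = if IsN0 E h then 0 else PurePowerFlag.tangency h := by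
  by_cases hn : IsN0 E h
  · rw [flagTriple_of_isN0 hn, if_pos hn]; rfl
  · rw [flagTriple_of_not_isN0 hn, if_neg hn]; rfl

/-- Tangent flags have `s = 0`. -/
theorem flagTriple_snd_snd_of_not_isN0 {A : Fin d → MvPowerSeries (Fin 2) k} {E : Finset (Fin 2)} {g : MvPowerSeries (Fin 2) k}
    {h : PowerSeries k} (hn : ¬ IsN0 E h) : (ofLex (ofLex (flagTriple d A E g h)).2).2 = 0 := by
  rw [flagTriple_of_not_isN0 hn]; rfl

/-! ## Swap-equivariance by construction -/

/-- THE SET OF FLAG TRIPLES IS SWAP-SYMMETRIC (by construction, as stub-1's `isFlagTriple_swap`). -/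
theorem isFlagTriple_swapT (d : ℕ) (A : Fin d → MvPowerSeries (Fin 2) k) (E : Finset (Fin 2)) (v : Triple) :
    IsFlagTriple d (swapT A) (swapE E) v ↔ IsFlagTriple d A E v := by
  constructor
  · rintro ⟨o, g, h, hg, hh, hadm, hmax, hv⟩
    refine ⟨!o, g, h, hg, hh, ?_, ?_, ?_⟩
    · rwa [PurePowerFlag.orientE_swapE] at hadm
    · rwa [orientT_swapT, PurePowerFlag.orientE_swapE] at hmax
    · rwa [orientT_swapT, PurePowerFlag.orientE_swapE] at hv
  · rintro ⟨o, g, h, hg, hh, hadm, hmax, hv⟩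
    refine ⟨!o, g, h, hg, hh, ?_, ?_, ?_⟩
    · rwa [PurePowerFlag.orientE_swapE, Bool.not_not]
    · rwa [orientT_swapT, PurePowerFlag.orientE_swapE, Bool.not_not]
    · rwa [orientT_swapT, PurePowerFlag.orientE_swapE, Bool.not_not]

/-- A valid admissible flag of the first orientation witnesses its triple. -/
theorem isFlagTriple_of_first {A : Fin d → MvPowerSeries (Fin 2) k} {E : Finset (Fin 2)} {g : MvPowerSeries (Fin 2) k} {h : PowerSeries k}
    (hg : constantCoeff g = 0) (hh : PowerSeries.constantCoeff h = 0) (hadm : IsN0 E h ∨ IsTangent E h) (hmax : IsMMax d A E g h) :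
    IsFlagTriple d A E (flagTriple d A E g h) :=
  ⟨false, g, h, hg, hh, hadm, hmax, rfl⟩

/-- … and of the second orientation (read on the swapped tuple and letters). -/
theorem isFlagTriple_of_second {A : Fin d → MvPowerSeries (Fin 2) k} {E : Finset (Fin 2)} {g : MvPowerSeries (Fin 2) k}
    {h : PowerSeries k} (hg : constantCoeff g = 0) (hh : PowerSeries.constantCoeff h = 0)
    (hadm : IsN0 (swapE E) h ∨ IsTangent (swapE E) h) (hmax : IsMMax d (swapT A) (swapE E) g h) :
    IsFlagTriple d A E (flagTriple d (swapT A) (swapE E) g h) :=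
  ⟨true, g, h, hg, hh, hadm, hmax, rfl⟩

end WildMonic

end Summit.ResolutionOfSingularities.ResolutionOfSingularities.Theorems

end
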